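import Mathlib
import HarnessLib
import Literature.MathematicalPhysics.QuantumLattice.TorusShellCountRegularBand
import Literature.MathematicalPhysics.QuantumLattice.SliceCutoffGramConstant
import Literature.MathematicalPhysics.QuantumLattice.HubbardCTSliceGram
import Summits.HubbardSuperconductivity.HubbardSuperconductivity.Theorems.KLProgrammeKLRegimeEngineScaleZeroCovariance
import Summits.HubbardSuperconductivity.HubbardSuperconductivity.Theorems.KLProgrammeKLRegimeSplitThermalLayer

/-!
# Route `KLProgramme`, crux K3 (children ENGINE `KLRegimeEngineV7`/V9 stub `stub_engine_scale0`, and VOLUME-LIMIT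
# `KLRegimeVolumeLimitV7`/V9): the LEVEL COUNT OF THE FRAME BAND on the torus grid, uniform over admissible frames

Cell gate-hubbard-kl, seat hubbard-kl-k3c4-p1 (prover; technique «FST2 volume lemmas route (t4's module)»), answering
k3c2-p1's WANTED (I2) (HOME STATUS 18:02Z/18:24Z): the ONE geometric input the scale-`0` engine step still lacked.
For every frame `K` admissible in the sense of the cell's predicate `FrameOK R U N μ K` — whose clause (i) is FST II's
`GeomConstants (frameLevel μ K) 7 (3/80) (1/2) (3/200)` (all derivatives of order `≤ 2` of the frame band
`e_K = ε - μ - K` bounded by `7`, `|∇e_K| ≥ 1/2` on the tube `{|e_K| < 3/80}`) — and for EVERY side `L ≥ 1`: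

* `card_frameLevel_lt_le`:  `#{k⃗ ∈ (ℤ/Lℤ)² : |e_K(p_k⃗)| < η} ≤ 1793·η·L² + 704·L`   for `0 < η ≤ 3/80`;
* `card_frameLevel_le_le`:  `#{k⃗ ∈ (ℤ/Lℤ)² : |e_K(p_k⃗)| ≤ η} ≤ 1793·η·L² + 704·L`   for `0 ≤ η < 3/80`;
* `card_klShell_le`:        `#klShell L μ K n ≤ 1793·Λ_n·L² + 704·L` at every scale `n` (`Λ_n = 4⁻ⁿ/32`).

Here `e_K(p_k⃗) = nambuXiCT L μ K k⃗` (`nambuXiCT_eq_frameLevel`: the torus band IS the continuum frame level at the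
lattice momentum), and the constants are `(8N/(πg₀), 2N)` of
`Literature/…/TorusShellCountRegularBand.card_filter_abs_lt_le_of_geomConstants` at `Kc = 7`, `g₀ = 1/2`, `N = 352`
(`8π·7 ≤ 352/2` since `π < 3.1416`; `5632/π ≤ 1793` since `π > 3.1415`) — uniform in the frame, `β`, `U`, `c`, `μ`, `n`
and `L`; no `L ≥ L₀` threshold (the count is taken at the grid points; Salmhofer 1998 Lemma 4's slices, discretised).
`card_frameLevel_lt_le` is LITERALLY the hypothesis `hcount` of
`Literature.….InfraredCutoffGramConstant.sum_one_sub_hubbardCutoffWeightCT_div_sqrt_le` (k3c2-p1, p457560) with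
`(c₁, c₂) = (1793, 704)`: with it the infrared Gram constant `κ_IR² ≤ 7·1793·Λ + (Λ + 8)·704` and the scale-`0`
determinant constant `δ₀² = 2(7 + κ_IR²)` (`HubbardCTScaleZeroDetBound`, p460184) hold for every admissible frame,
`β`-, `L ≥ β`- and `M`-uniformly: `infraredGram_frame_le` packages the first, and
`isDetBoundedR_scaleZero_of_frameOK_sharp` / `isGramBoundedR_scaleZero_of_frameOK_sharp` are the threshold-free, sharper
twins (`δ₀ = √(2·(7 + 6047)) ≈ 110`, every `L ≥ β`) of k3c2-p1's `EngineV8.isDetBoundedR_scaleZero_of_frameOK` /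
`…isGramBoundedR…` (p463843: `2^{15} ≤ L`, `δ₀ = √(2·(7 + 1606732)) ≈ 1793`, from the route-(β) count
`EngineV8.card_filter_nambuXiCT_lt_le_of_frameOK`, p463166, whose `nambuXiCT_eq_frameLevel` / `contDiff_frameLevel` we reuse).
APPENDED (§ slices): `sliceGram_frame_le` / `sliceGram_frame_scale_le` — the phase-space sum of ONE slice `w^K_Λ - w^K_{Λ′}` of
the frame covariance (`Literature/…/SliceCutoffGramConstant.sum_sliceWeightCT_div_sqrt_le`, BGM 2006 (2.80) sup × count) with the
count discharged: `≤ (2/Λ)(Λ′β/π + 3)(1793Λ′L² + 704L)`, at the scales `(Λ_{n+1}, Λ_n]`: `≲ Λ_n·βL²` — the Fourier–Gram constants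
`κ_n² ≲ Λ_n` of `stub_engine_step_norms`, uniformly in the frame, every `L ≥ 1` (scale arithmetic from `…SplitThermalLayer`'s `klth_klScale_succ/_pos`);
and (§ Gram) `sectorGramF_sliceCT_frame_le` / `sectorGramG_sliceCT_frame_le` — the same as bounds on the Gram VECTORS `‖F_Y‖², ‖G_Y‖²` of the
slice in the representation `contr = ⟪F, G⟫` of `HubbardSectorPropagatorGram` (`Literature/…/HubbardCTSliceGram`, sup × count), multipliers
`‖F_ω‖ ≤ 1`: `≤ ‖(βL²)⁻¹‖²·(Λ′β/π + 3)(1793Λ′L² + 704L)·(2βL²/Λ)`; and (§ replica-Gram) **`isGramBoundedR_sliceCT_of_frameOK`** /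
`isGramBoundedR_sliceCT_scale_of_frameOK`: `IsGramBoundedR (Sᵀ·C^K_{(Λ,Λ′]}·S) κ` with that `κ²` — the LITERAL covariance hypothesis of
`GrassmannEffectiveActionBoundDB.sum_norm_kernel_effAction_le_of_gramBounded` for every scale-`n` step of `stub_engine_step_norms`, every
admissible frame, every `L ≥ 1`, `M ≥ 1`.
For the volume-limit child the count is the `L`-uniform density-of-states majorant every termwise `L → ∞` limit of the
sectorised expansion is dominated by.  Everything PROVED; no definition, no named fact. [folklore]
-/

noncomputable section

-- the tree's namespace `Summit.<Summit>.<Problem>.Theorems` repeats the summit name by design (D-0017)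
set_option linter.dupNamespace false

namespace Summit.HubbardSuperconductivity.HubbardSuperconductivity.Theorems.KLRegimeSplit

open Real Finset Literature.MathematicalPhysics.QuantumLattice Literature.Probability.LatticeModels
open Literature.MathematicalPhysics.QuantumLattice.FermiRG
open Summit.HubbardSuperconductivity.HubbardSuperconductivity.Theorems.DispersionFlow
open Summit.HubbardSuperconductivity.HubbardSuperconductivity.Theorems.KLProgrammeLegKernels

variable {L : ℕ} [NeZero L]

/-- The numerics of the constants: `8π·7 ≤ (1/2)·352` (`π < 3.1416`). -/
theorem frameShellCount_N_ge : 8 * π * 7 ≤ 1 / 2 * ((352 : ℕ) : ℝ) := by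
  have := Real.pi_lt_d4
  push_cast
  nlinarith

/-- The numerics of the constants: `8·352/(π·(1/2)) ≤ 1793` (`π > 3.1415`). -/
theorem frameShellCount_c1_le : 8 * ((352 : ℕ) : ℝ) / (π * (1 / 2)) ≤ 1793 := by
  have hπ := Real.pi_gt_d4
  have hπ0 : 0 < π * (1 / 2) := by positivity
  rw [div_le_iff₀ hπ0]
  push_cast
  nlinarith

/-- **Level count of the frame band, strict shell** — the `hcount` hypothesis of
`InfraredCutoffGramConstant.sum_one_sub_hubbardCutoffWeightCT_div_sqrt_le` for EVERY admissible frame: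
`FrameOK R U N μ K → 0 < η ≤ 3/80 → #{k⃗ : |e_K(p_k⃗)| < η} ≤ 1793·η·L² + 704·L`, every `L ≥ 1`
(only clause (i) `GeomConstants (frameLevel μ K) 7 (3/80) (1/2) (3/200)` of `FrameOK` is used). -/
theorem card_frameLevel_lt_le {R : RenConsts} {U : ℝ} {N : ℕ} {μ : ℝ} {K : TrigPolyC4v} (hK : FrameOK R U N μ K)
    {η : ℝ} (hη : 0 < η) (hηr : η ≤ 3 / 80) :
    (((univ : Finset (TorusSite 2 L)).filter fun k => |nambuXiCT L μ K k| < η).card : ℝ) ≤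
      1793 * η * (L : ℝ) ^ 2 + 704 * L := by
  have hL : (0 : ℝ) ≤ L := Nat.cast_nonneg L
  have main := card_filter_abs_lt_le_of_geomConstants (L := L) (frameLevel μ K) (EngineV8.contDiff_frameLevel μ K) hK.1
    (N := 352) (by norm_num) frameShellCount_N_ge hη hηr
  have hset : ((univ : Finset (TorusSite 2 L)).filter fun k => |nambuXiCT L μ K k| < η) =
      (univ : Finset (TorusSite 2 L)).filter fun k => |frameLevel μ K (WithLp.toLp 2 (latticeMomentum L k))| < η := by
    refine Finset.filter_congr fun k _ => ?_
    rw [EngineV8.nambuXiCT_eq_frameLevel]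
  rw [hset]
  refine main.trans ?_
  have h1 := frameShellCount_c1_le
  have h2 : 0 ≤ η * (L : ℝ) ^ 2 := by positivity
  push_cast at h1 ⊢
  nlinarith

/-- **Level count of the frame band, closed shell**: `FrameOK R U N μ K → 0 ≤ η < 3/80 →
#{k⃗ : |e_K(p_k⃗)| ≤ η} ≤ 1793·η·L² + 704·L`, every `L ≥ 1`. -/
theorem card_frameLevel_le_le {R : RenConsts} {U : ℝ} {N : ℕ} {μ : ℝ} {K : TrigPolyC4v} (hK : FrameOK R U N μ K)
    {η : ℝ} (hη : 0 ≤ η) (hηr : η < 3 / 80) :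
    (((univ : Finset (TorusSite 2 L)).filter fun k => |nambuXiCT L μ K k| ≤ η).card : ℝ) ≤
      1793 * η * (L : ℝ) ^ 2 + 704 * L := by
  have hL : (0 : ℝ) ≤ L := Nat.cast_nonneg L
  have main := card_filter_abs_le_le_of_geomConstants (L := L) (frameLevel μ K) (EngineV8.contDiff_frameLevel μ K) hK.1
    (N := 352) (by norm_num) frameShellCount_N_ge hη hηr
  have hset : ((univ : Finset (TorusSite 2 L)).filter fun k => |nambuXiCT L μ K k| ≤ η) =
      (univ : Finset (TorusSite 2 L)).filter fun k => |frameLevel μ K (WithLp.toLp 2 (latticeMomentum L k))| ≤ η := by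
    refine Finset.filter_congr fun k _ => ?_
    rw [EngineV8.nambuXiCT_eq_frameLevel]
  rw [hset]
  refine main.trans ?_
  have h1 := frameShellCount_c1_le
  have h2 : 0 ≤ η * (L : ℝ) ^ 2 := by positivity
  push_cast at h1 ⊢
  nlinarith

/-- The scales stay inside the tube: `Λ_n = 4⁻ⁿ/32 < 3/80`. -/
theorem klScale_klE0_lt_tube (n : ℕ) : klScale klE0 n < 3 / 80 := by
  rw [klScale, klE0]
  have h4 : (1 : ℝ) ≤ (4 : ℝ) ^ n := one_le_pow₀ (by norm_num)
  have hinv : ((4 : ℝ) ^ n)⁻¹ ≤ 1 := inv_le_one_of_one_le₀ h4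
  have hpos : 0 < ((4 : ℝ) ^ n)⁻¹ := by positivity
  nlinarith

/-- `0 ≤ Λ_n`. -/
theorem klScale_klE0_nonneg (n : ℕ) : 0 ≤ klScale klE0 n := by
  rw [klScale, klE0]; positivity

/-- **The scale-`n` shell of an admissible frame is thin on the grid, uniformly**:
`FrameOK R U N μ K → #klShell L μ K n ≤ 1793·Λ_n·L² + 704·L` for every scale `n` and every `L ≥ 1` — the finite-volume
phase-space factor `Λ_n` of the single-scale power counting, with the `O(L)` rounding term. -/
theorem card_klShell_le {R : RenConsts} {U : ℝ} {N : ℕ} {μ : ℝ} {K : TrigPolyC4v} (hK : FrameOK R U N μ K) (n : ℕ) :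
    ((klShell L μ K n).card : ℝ) ≤ 1793 * klScale klE0 n * (L : ℝ) ^ 2 + 704 * L := by
  have h := card_frameLevel_le_le (L := L) hK (klScale_klE0_nonneg n) (klScale_klE0_lt_tube n)
  have hset : klShell L μ K n = (univ : Finset (TorusSite 2 L)).filter fun k => |nambuXiCT L μ K k| ≤ klScale klE0 n := by
    ext k
    rw [klShell, mem_momentumShell, Finset.mem_filter]
    simp
  rw [hset]
  exact h

/-- **The infrared Gram constant of the scale-`Λ` cutoff remainder is bounded for every admissible frame** (k3c2-p1's
`sum_one_sub_hubbardCutoffWeightCT_div_sqrt_le` with its level-count hypothesis DISCHARGED): for `FrameOK R U N μ K`,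
`0 < β ≤ L`, `π/β ≤ Λ ≤ 3/80`, every Matsubara cutoff `M`:
`Σ_{(ω,k⃗)} (1 - w^K_Λ)/√(ω² + e_K²) ≤ (7·1793·Λ + (Λ + 8)·704)·β·L²`. -/
theorem infraredGram_frame_le {M : ℕ} {R : RenConsts} {U : ℝ} {N : ℕ} {μ : ℝ} {K : TrigPolyC4v}
    (hK : FrameOK R U N μ K) {β Λ : ℝ} (hβ : 0 < β) (hΛ : 0 < Λ) (hΛβ : Real.pi / β ≤ Λ) (hΛr : Λ ≤ 3 / 80)
    (hβL : β ≤ L) :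
    ∑ k : FreqMomentum L M, (1 - hubbardCutoffWeightCT L M β μ K Λ k) /
        Real.sqrt (matsubaraFreq β M k.1 ^ 2 + nambuXiCT L μ K k.2 ^ 2) ≤
      (7 * 1793 * Λ + (Λ + 8) * 704) * β * (L : ℝ) ^ 2 :=
  sum_one_sub_hubbardCutoffWeightCT_div_sqrt_le hβ μ K hΛ hΛβ hβL (by norm_num) (by norm_num)
    fun η hη hηΛ => card_frameLevel_lt_le hK hη (hηΛ.trans hΛr)

/-- **The scale-`0` covariance of the KL carrier is determinant-bounded with `δ₀ = √(2·(7 + 6047)) ≈ 110` for EVERY side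
`L ≥ β`** — the threshold-free, sharper twin of `EngineV8.isDetBoundedR_scaleZero_of_frameOK` (there: `2^{15} ≤ L`,
`δ₀ = √(2·(7 + 1606732)) ≈ 1793`): for every admissible frame (`FrameOK R U N μ K`), `klBetaMin ≤ β ≤ L`, every Matsubara cutoff
`M ≥ 1`, `IsDetBoundedR q ((hubbardGridSub L M β (4M))ᵀ · hubbardCovAboveCT L M β μ 0 K e₀ · hubbardGridSub L M β (4M)) √(2·(7 + 6047))`
(`κ_IR² ≤ 7·1793/32 + (1/32 + 8)·704 ≤ 6047` from `infraredGram_frame_le` at `Λ = e₀ = 1/32`). -/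
theorem isDetBoundedR_scaleZero_of_frameOK_sharp {R : RenConsts} {U : ℝ} {N : ℕ} {μ : ℝ} {K : TrigPolyC4v}
    (hK : FrameOK R U N μ K) {β : ℝ} (hβ : klBetaMin ≤ β) {M : ℕ} [NeZero M] (hβL : β ≤ L) :
    IsDetBoundedR (fun X : GridLeg (GridPoint L (2 * (2 * M))) => decide (X.2 = 0))
      ((hubbardGridSub L M β (2 * (2 * M))).transpose * hubbardCovAboveCT L M β μ 0 K klE0 *
        hubbardGridSub L M β (2 * (2 * M)))
      (Real.sqrt (2 * (7 + 6047))) := by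
  have hβpos : 0 < β := lt_of_lt_of_le (by norm_num [klBetaMin]) hβ
  have hLpos : (0 : ℝ) < L := by exact_mod_cast Nat.pos_of_ne_zero (NeZero.ne L)
  have he₀ : (0 : ℝ) < klE0 := by norm_num [klE0]
  have he₀' : klE0 ≤ 3 / 80 := by norm_num [klE0]
  have hπβ : Real.pi / β ≤ klE0 := by
    rw [div_le_iff₀ hβpos, klE0]
    have h128 : (128 : ℝ) ≤ β := by simpa [klBetaMin] using hβ
    nlinarith [Real.pi_lt_four]
  have hsum := infraredGram_frame_le (L := L) (M := M) hK hβpos he₀ hπβ he₀' hβL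
  have hκ : 1 / (β * (L : ℝ) ^ 2) * ∑ k : FreqMomentum L M,
      (1 - hubbardCutoffWeightCT L M β μ K klE0 k) / Real.sqrt (matsubaraFreq β M k.1 ^ 2 + nambuXiCT L μ K k.2 ^ 2) ≤
        (Real.sqrt 6047) ^ 2 := by
    rw [Real.sq_sqrt (by norm_num)]
    have hβL2 : 0 < β * (L : ℝ) ^ 2 := by positivity
    rw [one_div, inv_mul_le_iff₀ hβL2]
    refine hsum.trans ?_
    rw [klE0]
    nlinarith
  have h := isDetBoundedR_gridSub_hubbardCovAboveCT (L := L) (M := M) hβpos μ K klE0 hκ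
  rwa [Real.sq_sqrt (by norm_num)] at h

/-- **The scale-`0` covariance of the KL carrier is replica-Gram-bounded with `√(2·(7 + 6047))` for every side `L ≥ β`** —
the threshold-free, sharper twin of `EngineV8.isGramBoundedR_scaleZero_of_frameOK` (the literal covariance hypothesis of
`GrassmannEffectiveActionBoundDB.sum_norm_kernel_effAction_le_of_gramBounded` for the scale-`0` step `stub_engine_scale0`). -/
theorem isGramBoundedR_scaleZero_of_frameOK_sharp {R : RenConsts} {U : ℝ} {N : ℕ} {μ : ℝ} {K : TrigPolyC4v}
    (hK : FrameOK R U N μ K) {β : ℝ} (hβ : klBetaMin ≤ β) {M : ℕ} [NeZero M] (hβL : β ≤ L) :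
    IsGramBoundedR
      ((hubbardGridSub L M β (2 * (2 * M))).transpose * hubbardCovAboveCT L M β μ 0 K klE0 *
        hubbardGridSub L M β (2 * (2 * M)))
      (Real.sqrt (2 * (7 + 6047))) :=
  (isDetBoundedR_scaleZero_of_frameOK_sharp (L := L) hK hβ hβL).isGramBoundedR
    (fun _ _ h => EngineV8.gridSub_hubbardCovAboveCT_apply_of_charge_eq β μ K klE0 (2 * (2 * M)) h) (Real.sqrt_nonneg _)

/-! ## The single-slice phase-space sums at the scales `n ≥ 1` (appended; the Fourier–Gram constants of `stub_engine_step_norms`) -/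

/-- **The phase-space sum of ONE slice of the frame covariance, for every admissible frame** (BGM 2006 (2.80), sup × count,
with the level count DISCHARGED by `card_frameLevel_lt_le`): for `FrameOK R U N μ K`, `0 < β`, `0 < Λ ≤ Λ′ ≤ 3/80`, every
`L ≥ 1` and every Matsubara cutoff `M`:
`Σ_{(ω,k⃗)} |w^K_Λ - w^K_{Λ′}| / √(ω² + e_K²) ≤ (2/Λ)·((Λ′β/π + 3)·(1793·Λ′·L² + 704·L))` — `βL²` times the Fourier–Gram constant
of the slice `C^K_{(Λ,Λ′]}` (`hubbardCovSliceCT`), uniformly in the frame. -/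
theorem sliceGram_frame_le {M : ℕ} {R : RenConsts} {U : ℝ} {N : ℕ} {μ : ℝ} {K : TrigPolyC4v}
    (hK : FrameOK R U N μ K) {β Λ Λ' : ℝ} (hβ : 0 < β) (hΛ : 0 < Λ) (hΛΛ' : Λ ≤ Λ') (hΛ'r : Λ' ≤ 3 / 80) :
    ∑ k : FreqMomentum L M, |hubbardCutoffWeightCT L M β μ K Λ k - hubbardCutoffWeightCT L M β μ K Λ' k| /
        Real.sqrt (matsubaraFreq β M k.1 ^ 2 + nambuXiCT L μ K k.2 ^ 2) ≤
      2 / Λ * ((Λ' * β / Real.pi + 3) * (1793 * Λ' * (L : ℝ) ^ 2 + 704 * L)) :=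
  sum_sliceWeightCT_div_sqrt_le hβ μ K hΛ hΛΛ' (by norm_num) (by norm_num)
    (card_frameLevel_lt_le hK (hΛ.trans_le hΛΛ') hΛ'r)

/-- **The scale-`(n+1)` slice of an admissible frame has phase-space sum `≲ Λ_n·βL²`** (every scale `n`, every `L ≥ 1`, every
`β > 0`, every `M`): with `Λ = Λ_{n+1} = Λ_n/4`, `Λ′ = Λ_n`,
`Σ_{(ω,k⃗)} |w^K_{Λ_{n+1}} - w^K_{Λ_n}| / √(ω² + e_K²) ≤ (8/Λ_n)·((Λ_nβ/π + 3)·(1793·Λ_n·L² + 704·L))`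
`= (8·1793/π)·Λ_n·βL² + O(L² + βL + L/Λ_n)` — the single-scale power-counting factor `κ_n² ≲ Λ_n` of the sectorless Gram
representation (BGM 2006 (2.80) at finite `(β, L)`), uniformly in the frame. -/
theorem sliceGram_frame_scale_le {M : ℕ} {R : RenConsts} {U : ℝ} {N : ℕ} {μ : ℝ} {K : TrigPolyC4v}
    (hK : FrameOK R U N μ K) {β : ℝ} (hβ : 0 < β) (n : ℕ) :
    ∑ k : FreqMomentum L M, |hubbardCutoffWeightCT L M β μ K (klScale klE0 (n + 1)) k -
          hubbardCutoffWeightCT L M β μ K (klScale klE0 n) k| /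
        Real.sqrt (matsubaraFreq β M k.1 ^ 2 + nambuXiCT L μ K k.2 ^ 2) ≤
      8 / klScale klE0 n * ((klScale klE0 n * β / Real.pi + 3) * (1793 * klScale klE0 n * (L : ℝ) ^ 2 + 704 * L)) := by
  have hn := klth_klScale_pos n
  have h := sliceGram_frame_le (L := L) (M := M) hK hβ (klth_klScale_pos (n + 1))
    (by rw [klth_klScale_succ]; linarith) (klScale_klE0_lt_tube n).le
  have h8 : 2 / klScale klE0 (n + 1) = 8 / klScale klE0 n := by
    rw [klth_klScale_succ]; field_simp; ring
  rw [h8] at h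
  exact h

/-! ## The Gram constants of the single slices for admissible frames (appended; the covariance input of `stub_engine_step_norms`
in the Gram representation `contr C = ⟪F_X, G_Y⟫` of `HubbardSectorPropagatorGram` / `HubbardCovarianceCTNormalForm`) -/

/-- **The Gram constant (left vector) of ONE slice of an admissible frame's covariance** — `Literature/…/HubbardCTSliceGram`'s
`norm_sq_sectorGramF_sliceCT_le` with the level count DISCHARGED: for `FrameOK R U N μ K`, multipliers `‖F_ω(k)‖ ≤ 1`, `0 < β`,
`0 < Λ ≤ Λ′ ≤ 3/80`, every `L ≥ 1`, `M`, and every label `Y`: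
`‖F_Y‖² ≤ ‖(βL²)⁻¹‖² · [(Λ′β/π + 3)·(1793·Λ′·L² + 704·L)] · (2βL²/Λ)` (symbol of `hubbardCovSliceCT_zero_seed`). -/
theorem sectorGramF_sliceCT_frame_le {M N' : ℕ} {R : RenConsts} {U : ℝ} {N : ℕ} {μ : ℝ} {K : TrigPolyC4v}
    (hK : FrameOK R U N μ K) {β Λ Λ' : ℝ} (hβ : 0 < β) (hΛ : 0 < Λ) (hΛΛ' : Λ ≤ Λ') (hΛ'r : Λ' ≤ 3 / 80)
    (F : Fin N' → FreqMomentum L M → ℂ) (hF : ∀ ω k, ‖F ω k‖ ≤ 1) (Y : SpaceTimeIdx L M × SectorLeg N') :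
    ‖sectorGramF L M β F (fun ks => ((hubbardCutoffWeightCT L M β μ K Λ ks.1 : ℂ) - (hubbardCutoffWeightCT L M β μ K Λ' ks.1 : ℂ)) *
        (((β * (L : ℝ) ^ 2 : ℝ) : ℂ) *
          ((Complex.I * matsubaraFreq β M ks.1.1 + nambuXiCT L μ K ks.1.2) / nambuDenCT L M β μ 0 K ks.1))) Y‖ ^ 2 ≤
      ‖((1 / (β * (L : ℝ) ^ 2) : ℝ) : ℂ)‖ ^ 2 *
        (((Λ' * β / Real.pi + 3) * (1793 * Λ' * (L : ℝ) ^ 2 + 704 * L)) * (2 * (β * (L : ℝ) ^ 2) / Λ)) :=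
  norm_sq_sectorGramF_sliceCT_le hβ μ K hΛ hΛΛ' (card_frameLevel_lt_le hK (hΛ.trans_le hΛΛ') hΛ'r) F hF Y

/-- **The Gram constant (right vector) of ONE slice of an admissible frame's covariance**: the same bound for `‖G_Y‖²`. -/
theorem sectorGramG_sliceCT_frame_le {M N' : ℕ} {R : RenConsts} {U : ℝ} {N : ℕ} {μ : ℝ} {K : TrigPolyC4v}
    (hK : FrameOK R U N μ K) {β Λ Λ' : ℝ} (hβ : 0 < β) (hΛ : 0 < Λ) (hΛΛ' : Λ ≤ Λ') (hΛ'r : Λ' ≤ 3 / 80)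
    (F : Fin N' → FreqMomentum L M → ℂ) (hF : ∀ ω k, ‖F ω k‖ ≤ 1) (Y' : SpaceTimeIdx L M × SectorLeg N') :
    ‖sectorGramG L M β F (fun ks => ((hubbardCutoffWeightCT L M β μ K Λ ks.1 : ℂ) - (hubbardCutoffWeightCT L M β μ K Λ' ks.1 : ℂ)) *
        (((β * (L : ℝ) ^ 2 : ℝ) : ℂ) *
          ((Complex.I * matsubaraFreq β M ks.1.1 + nambuXiCT L μ K ks.1.2) / nambuDenCT L M β μ 0 K ks.1))) Y'‖ ^ 2 ≤
      ‖((1 / (β * (L : ℝ) ^ 2) : ℝ) : ℂ)‖ ^ 2 *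
        (((Λ' * β / Real.pi + 3) * (1793 * Λ' * (L : ℝ) ^ 2 + 704 * L)) * (2 * (β * (L : ℝ) ^ 2) / Λ)) :=
  norm_sq_sectorGramG_sliceCT_le hβ μ K hΛ hΛΛ' (card_frameLevel_lt_le hK (hΛ.trans_le hΛΛ') hΛ'r) F hF Y'

/-! ## The replica-Gram bound of the single slices for admissible frames (appended): the literal covariance hypothesis of
`GrassmannEffectiveActionBoundDB.sum_norm_kernel_effAction_le_of_gramBounded` at the scales `n ≥ 1` -/

/-- **The sectorised slice of an ADMISSIBLE frame's covariance is replica-Gram-bounded, every `L ≥ 1`**: for `FrameOK R U N μ K`,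
`0 < β`, `0 < Λ ≤ Λ′ ≤ 3/80`, multipliers `‖F_ω(k)‖ ≤ 1`, every Matsubara cutoff `M ≥ 1`:
`IsGramBoundedR (Sᵀ·C^K_{(Λ,Λ′]}·S) √(‖(βL²)⁻¹‖²·(Λ′β/π + 3)·(1793Λ′L² + 704L)·(2βL²/Λ))`, `S = sectorSubMatrix L M β F`
(`Literature/…/HubbardCTSliceGram.isGramBoundedR_sectorSub_sliceCT` with the level count discharged by `card_frameLevel_lt_le`). -/
theorem isGramBoundedR_sliceCT_of_frameOK {M N' : ℕ} [NeZero M] {R : RenConsts} {U : ℝ} {N : ℕ} {μ : ℝ} {K : TrigPolyC4v}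
    (hK : FrameOK R U N μ K) {β Λ Λ' : ℝ} (hβ : 0 < β) (hΛ : 0 < Λ) (hΛΛ' : Λ ≤ Λ') (hΛ'r : Λ' ≤ 3 / 80)
    (F : Fin N' → FreqMomentum L M → ℂ) (hF : ∀ ω k, ‖F ω k‖ ≤ 1) :
    IsGramBoundedR ((sectorSubMatrix L M β F).transpose * hubbardCovSliceCT L M β μ 0 K Λ Λ' * sectorSubMatrix L M β F)
      (Real.sqrt (‖((1 / (β * (L : ℝ) ^ 2) : ℝ) : ℂ)‖ ^ 2 *
        (((Λ' * β / Real.pi + 3) * (1793 * Λ' * (L : ℝ) ^ 2 + 704 * L)) * (2 * (β * (L : ℝ) ^ 2) / Λ)))) :=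
  isGramBoundedR_sectorSub_sliceCT hβ μ K hΛ hΛΛ' (card_frameLevel_lt_le hK (hΛ.trans_le hΛΛ') hΛ'r) F hF

/-- **The scale-`(n+1)` slice** `(Λ_{n+1}, Λ_n]` of an admissible frame's covariance is replica-Gram-bounded with
`κ_n² = ‖(βL²)⁻¹‖²·(Λ_nβ/π + 3)·(1793Λ_nL² + 704L)·(8βL²/Λ_n)` (`≍ Λ_n` up to the field normalisation; every scale `n`, `L ≥ 1`,
`β > 0`, `M ≥ 1`, multipliers `‖F_ω‖ ≤ 1`). -/
theorem isGramBoundedR_sliceCT_scale_of_frameOK {M N' : ℕ} [NeZero M] {R : RenConsts} {U : ℝ} {N : ℕ} {μ : ℝ} {K : TrigPolyC4v}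
    (hK : FrameOK R U N μ K) {β : ℝ} (hβ : 0 < β) (n : ℕ) (F : Fin N' → FreqMomentum L M → ℂ) (hF : ∀ ω k, ‖F ω k‖ ≤ 1) :
    IsGramBoundedR ((sectorSubMatrix L M β F).transpose *
        hubbardCovSliceCT L M β μ 0 K (klScale klE0 (n + 1)) (klScale klE0 n) * sectorSubMatrix L M β F)
      (Real.sqrt (‖((1 / (β * (L : ℝ) ^ 2) : ℝ) : ℂ)‖ ^ 2 *
        (((klScale klE0 n * β / Real.pi + 3) * (1793 * klScale klE0 n * (L : ℝ) ^ 2 + 704 * L)) *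
          (8 * (β * (L : ℝ) ^ 2) / klScale klE0 n)))) := by
  have hn := klth_klScale_pos n
  have h := isGramBoundedR_sliceCT_of_frameOK (L := L) (M := M) hK hβ (klth_klScale_pos (n + 1))
    (by rw [klth_klScale_succ]; linarith) (klScale_klE0_lt_tube n).le F hF
  have h8 : 2 * (β * (L : ℝ) ^ 2) / klScale klE0 (n + 1) = 8 * (β * (L : ℝ) ^ 2) / klScale klE0 n := by
    rw [klth_klScale_succ]; field_simp; ring
  rw [h8] at h
  exact h

end Summit.HubbardSuperconductivity.HubbardSuperconductivity.Theorems.KLRegimeSplit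

end
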